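import Literature.Combinatorics.Enumerative.PfaffSaalschutz
import Mathlib.RingTheory.Binomial
import Mathlib.RingTheory.Polynomial.Pochhammer
import Mathlib.Data.Nat.Choose.Central
import Mathlib.Algebra.BigOperators.Intervals
import Mathlib.Algebra.BigOperators.NatAntidiagonal
import Mathlib.Tactic.FieldSimp
import Mathlib.Tactic.LinearCombination
import Mathlib.Tactic.Ring
import HarnessLib

/-!
# Booker–Krishnamurthy 2011, Appendix A: the binomial identities of Lemma A.1

A. R. Booker, M. Krishnamurthy, *A strengthening of the GL(2) converse theorem*, Compositio Math.
147 (2011), 669–715 [BookerKrishnamurthy2011], Appendix A "Binomial coefficients", Lemma A.1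
(p. 710) with its proof (pp. 711–713), read on the held text `paper:doi-10-1112-s0010437x10005087`
(PDF pp. 43–46). The binomial coefficient polynomials are
`C(x, n) = x (x-1) ⋯ (x-n+1) / n!` for `x ∈ ℂ`, `n ∈ ℤ_{≥0}` (and `0` for `n < 0`), i.e. Mathlib's
`Ring.choose x n` on the binomial ring `ℂ` (here: any field of characteristic zero), and the
lemma reads (the three sums are finite: `C(·, n-r) = 0` for `r > n`):

> **Lemma A.1.** For `x, y ∈ ℂ` and `n ∈ ℤ`, we have:
> (i)   `∑_{r=0}^{n} (-1)^r C(-x-1, r) C(-y-1, r) C(x+y+1, n-r) = (-1)^n C(x, n) C(y, n)`;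
> (ii)  `∑_{r ≥ 0} ((-4)^r / C(2r, r)) C(x+y, n-r) C(-x, r) C(-y-½, r)
>          = ((-4)^n / C(2n, n)) C(x-½, n) C(y, n)`;
> (iii) `∑_{r ≥ 0} ((-4)^r / C(2r, r)) ((2n+1)/(2r+1)) C(x+y, n-r) C(-x-1, r) C(-y-½, r)
>          = ((-4)^n / C(2n, n)) C(x-½, n) C(y-1, n)`.

These are the combinatorial inputs of §5.5 (proof of Lemma 5.2, the archimedean Mellin-transform
polynomials `P_v(s; m, n)`: (i) on pp. 703, 705, (ii) on pp. 708, 710, (iii) on p. 709), hence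
leaves of the printed proof of Theorem 1.1 and of Corollary 1.2 (the named fact
`Literature.NumberTheory.Automorphic.bookerKrishnamurthy_isPiOfArtinRep_of_entire_twists` of
`Automorphic/BookerKrishnamurthyConverse`). The displayed formulas of the scanned text are
garbled; the three statements above were reconstructed from it and confirmed by exact rational
evaluation for `n ≤ 5` before being proved here in general: `lemma_A1_i`, `lemma_A1_ii`,
`lemma_A1_iii`.

Proof. Not the paper's (a combinatorial identity (A2) plus Zariski density for (i); the
derivative identity (A4) for (ii)–(iii)), but a shorter road now in the tree: each of the three
sums is a balanced terminating `₃F₂(1)`, i.e. an instance of the **Pfaff–Saalschütz summation**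
`∑_k C(n,k) (a)_k (b)_k (c+k)_{n-k} (c-a-b)_{n-k} = (c-a)_n (c-b)_n`
(`Literature.Combinatorics.Enumerative.pfaffSaalschutz_antidiagonal`, Andrews–Askey–Roy Thm. 2.2.6),
namely `(a, b, c) = (x+1, y+1, 1)` for (i), `(x, y+½, ½)` for (ii) and `(x+1, y+½, 3/2)` for (iii),
after the conversions `k! C(z, k) = (-1)^k (-z)_k` (`factorial_mul_choose_eq_neg_pow_mul_prod`),
`4^k (½)_k = C(2k,k) k!` and `4^k (3/2)_k = C(2k,k) k! (2k+1)` (`four_pow_mul_prod_half_add`,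
`four_pow_mul_prod_three_halves_add`).

## References

* A. R. Booker, M. Krishnamurthy, Compositio Math. 147 (2011), Appendix A, Lemma A.1 (p. 710)
  and its proof (pp. 711–713); uses in §5.5 (pp. 703–710). [BookerKrishnamurthy2011]
* G. E. Andrews, R. Askey, R. Roy, *Special Functions* (1999), Thm. 2.2.6 (Pfaff–Saalschütz).
  [AndrewsAskeyRoy1999]

## Mathlib / tree search

`lean search 'Ring.choose_eq_smul|descPochhammer_eval_eq_prod_range|succ_mul_centralBinom_succ'`:
Mathlib; the conversion `Ring.choose a n = (∏_{j<n} (a-j)) / n!` exists in the tree only for `ℝ`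
(`Barriers/CriticalPhenomena/RigorousRGSmallParameterFracLaplacian`,
`NumberTheory/DiophantineGeometry/CatalanCasselsTheorem`), reproved here for any field of
characteristic zero in the division-free form `n! · Ring.choose a n = ∏_{j<n} (a-j)`.
-/

namespace Literature.NumberTheory.Automorphic

namespace BookerKrishnamurthy

open Finset Polynomial Literature.Combinatorics.Enumerative

variable {K : Type*} [Field K] [CharZero K]

/-! ### Binomial coefficient polynomials as products -/

/-- `k! · C(z, k) = z (z-1) ⋯ (z-k+1)` for the binomial coefficient polynomial `C(z, k)`
(Mathlib `Ring.choose`) over a field of characteristic zero (Booker–Krishnamurthy 2011, App. A,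
first display: "`C(x, n) = x(x-1)⋯(x-n+1)/n!`"). [folklore] -/
theorem factorial_mul_choose_eq_prod (z : K) (k : ℕ) :
    (k.factorial : K) * Ring.choose z k = ∏ j ∈ range k, (z - j) := by
  rw [Ring.choose_eq_smul, smul_eq_mul, ← Polynomial.aeval_eq_smeval, Polynomial.aeval_def,
    Polynomial.eval₂_eq_eval_map, descPochhammer_map, descPochhammer_eval_eq_prod_range,
    mul_inv_cancel_left₀ (by exact_mod_cast k.factorial_ne_zero)]

omit [CharZero K] in
/-- Falling factorial as a signed rising factorial: `∏_{j<k} (z-j) = (-1)^k ∏_{j<k} (-z+j)`.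
[folklore] -/
theorem prod_range_sub_natCast (z : K) (k : ℕ) :
    ∏ j ∈ range k, (z - j) = (-1) ^ k * ∏ j ∈ range k, (-z + j) := by
  induction k with
  | zero => simp
  | succ k ih => rw [prod_range_succ, prod_range_succ, ih]; ring

/-- `k! · C(z, k) = (-1)^k (-z)_k` with `(w)_k = ∏_{j<k} (w+j)` the rising factorial ("upper
negation", Booker–Krishnamurthy 2011, App. A: "`C(x, n) = (-1)^n C(n-1-x, n)`"). [folklore] -/
theorem factorial_mul_choose_eq_neg_pow_mul_prod (z : K) (k : ℕ) :
    (k.factorial : K) * Ring.choose z k = (-1) ^ k * ∏ j ∈ range k, (-z + j) := by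
  rw [factorial_mul_choose_eq_prod, prod_range_sub_natCast]

omit [CharZero K] in
/-- `k! · (k+1)_m = (k+m)!` (as elements of `K`). [folklore] -/
theorem factorial_mul_prod_one_add (k m : ℕ) :
    (k.factorial : K) * ∏ i ∈ range m, ((1 : K) + k + i) = ((k + m).factorial : K) := by
  induction m with
  | zero => simp
  | succ m ih =>
    rw [prod_range_succ, ← mul_assoc, ih, show k + (m + 1) = (k + m) + 1 by ring,
      Nat.factorial_succ]
    push_cast
    ring

/-- `C(k+m, k) k! m! = (k+m)!` (as elements of `K`; Mathlib `Nat.choose_mul_factorial_mul_factorial`).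
[folklore] -/
theorem choose_mul_factorial_mul_factorial_cast (k m : ℕ) :
    ((k + m).choose k : K) * k.factorial * m.factorial = ((k + m).factorial : K) := by
  have h := Nat.choose_mul_factorial_mul_factorial (Nat.le_add_right k m)
  rw [Nat.add_sub_cancel_left] at h
  exact_mod_cast h

/-- The central binomial coefficient as a rising factorial: `4^k (½)_k = C(2k, k) k!`
(from Mathlib `Nat.succ_mul_centralBinom_succ`). [folklore] -/
theorem four_pow_mul_prod_half_add (k : ℕ) :
    (4 : K) ^ k * ∏ i ∈ range k, ((1 : K) / 2 + i) = ((2 * k).choose k : K) * k.factorial := by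
  induction k with
  | zero => simp
  | succ k ih =>
    have h := Nat.succ_mul_centralBinom_succ k
    simp only [Nat.centralBinom] at h
    have h' := congrArg (Nat.cast (R := K)) h
    push_cast at h'
    rw [prod_range_succ, pow_succ, Nat.factorial_succ]
    push_cast
    linear_combination (4 * ((1 : K) / 2 + k)) * ih - (k.factorial : K) * h'

/-- `4^k (3/2)_k = C(2k, k) k! (2k+1)`. [folklore] -/
theorem four_pow_mul_prod_three_halves_add (k : ℕ) :
    (4 : K) ^ k * ∏ i ∈ range k, ((3 : K) / 2 + i) =
      ((2 * k).choose k : K) * k.factorial * (2 * k + 1) := by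
  induction k with
  | zero => simp
  | succ k ih =>
    have h := Nat.succ_mul_centralBinom_succ k
    simp only [Nat.centralBinom] at h
    have h' := congrArg (Nat.cast (R := K)) h
    push_cast at h'
    rw [prod_range_succ, pow_succ, Nat.factorial_succ]
    push_cast
    linear_combination (4 * ((3 : K) / 2 + k)) * ih - ((k.factorial : K) * (2 * k + 3)) * h'

omit [CharZero K] in
/-- `(w)_k (w+k)_m = (w)_{k+m}` for rising factorials. [folklore] -/
theorem prod_range_add_shift (w : K) (k m : ℕ) :
    (∏ i ∈ range k, (w + i)) * ∏ i ∈ range m, (w + k + i) = ∏ i ∈ range (k + m), (w + i) := by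
  rw [prod_range_add]
  congr 1
  refine prod_congr rfl fun i _ => ?_
  push_cast
  ring

/-- `(½)_k ≠ 0` in characteristic zero. [folklore] -/
theorem prod_half_add_ne_zero (k : ℕ) : ∏ i ∈ range k, ((1 : K) / 2 + i) ≠ 0 := by
  refine prod_ne_zero_iff.mpr fun i _ h => ?_
  have h2 : (2 * i + 1 : K) = 0 := by linear_combination 2 * h
  exact_mod_cast h2

/-- `(3/2)_k ≠ 0` in characteristic zero. [folklore] -/
theorem prod_three_halves_add_ne_zero (k : ℕ) : ∏ i ∈ range k, ((3 : K) / 2 + i) ≠ 0 := by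
  refine prod_ne_zero_iff.mpr fun i _ h => ?_
  have h2 : (2 * i + 3 : K) = 0 := by linear_combination 2 * h
  exact_mod_cast h2

/-- `(-4)^k / C(2k,k) = (-1)^k k! / (½)_k`. [folklore] -/
theorem neg_four_pow_div_centralBinom (k : ℕ) :
    (-4 : K) ^ k / ((2 * k).choose k : K) = (-1) ^ k * k.factorial / ∏ i ∈ range k, ((1 : K) / 2 + i) := by
  have hH := prod_half_add_ne_zero (K := K) k
  have hC : ((2 * k).choose k : K) ≠ 0 := by exact_mod_cast (Nat.choose_pos (by omega)).ne'
  have h4 := four_pow_mul_prod_half_add (K := K) k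
  rw [div_eq_div_iff hC hH, neg_pow (4 : K) k]
  linear_combination (-1 : K) ^ k * h4

/-- `(-4)^k / (C(2k,k) (2k+1)) = (-1)^k k! / (3/2)_k`. [folklore] -/
theorem neg_four_pow_div_centralBinom_div (k : ℕ) :
    (-4 : K) ^ k / ((2 * k).choose k : K) / (2 * k + 1) =
      (-1) ^ k * k.factorial / ∏ i ∈ range k, ((3 : K) / 2 + i) := by
  have hG := prod_three_halves_add_ne_zero (K := K) k
  have hC : ((2 * k).choose k : K) ≠ 0 := by exact_mod_cast (Nat.choose_pos (by omega)).ne'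
  have h21 : (2 * k + 1 : K) ≠ 0 := by exact_mod_cast Nat.succ_ne_zero (2 * k)
  have h4 := four_pow_mul_prod_three_halves_add (K := K) k
  rw [div_div, div_eq_div_iff (mul_ne_zero hC h21) hG, neg_pow (4 : K) k]
  linear_combination (-1 : K) ^ k * h4

/-! ### Lemma A.1 -/

/-- **Booker–Krishnamurthy 2011, Lemma A.1 (i)** (p. 710): for `x, y` in a field of
characteristic zero (the paper: `ℂ`) and `n ∈ ℕ`,
`∑_{r=0}^{n} (-1)^r C(-x-1, r) C(-y-1, r) C(x+y+1, n-r) = (-1)^n C(x, n) C(y, n)`, `C = Ring.choose`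
the binomial coefficient polynomial. (For `n < 0` both sides of the printed statement vanish.)
Pfaff–Saalschütz at `(a, b, c) = (x+1, y+1, 1)`. [cite: BookerKrishnamurthy2011, Lemma A.1 (i) (p. 710)] -/
theorem lemma_A1_i (x y : K) (n : ℕ) :
    ∑ r ∈ range (n + 1), (-1 : K) ^ r * Ring.choose (-x - 1) r * Ring.choose (-y - 1) r *
        Ring.choose (x + y + 1) (n - r) =
      (-1 : K) ^ n * Ring.choose x n * Ring.choose y n := by
  -- the Pfaff–Saalschütz summand and the termwise comparison
  set u : ℕ → ℕ → K := fun k m => ((k + m).choose k : K) * (∏ i ∈ range k, (x + 1 + i)) *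
    (∏ i ∈ range k, (y + 1 + i)) * (∏ i ∈ range m, ((1 : K) + k + i)) *
    (∏ i ∈ range m, (1 - (x + 1) - (y + 1) + i)) with hu
  set t : ℕ → ℕ → K := fun k m => (-1 : K) ^ k * Ring.choose (-x - 1) k *
    Ring.choose (-y - 1) k * Ring.choose (x + y + 1) m with ht
  have hterm : ∀ k m : ℕ,
      t k m = (-1) ^ (k + m) / (((k + m).factorial : K)) ^ 2 * u k m := by
    intro k m
    have h1 := factorial_mul_choose_eq_neg_pow_mul_prod (-x - 1) k
    have h2 := factorial_mul_choose_eq_neg_pow_mul_prod (-y - 1) k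
    have h3 := factorial_mul_choose_eq_neg_pow_mul_prod (x + y + 1) m
    have h4 := factorial_mul_prod_one_add (K := K) k m
    have h5 := choose_mul_factorial_mul_factorial_cast (K := K) k m
    have e1 : ∏ j ∈ range k, (-(-x - 1) + (j : K)) = ∏ i ∈ range k, (x + 1 + i) :=
      prod_congr rfl fun i _ => by ring
    have e2 : ∏ j ∈ range k, (-(-y - 1) + (j : K)) = ∏ i ∈ range k, (y + 1 + i) :=
      prod_congr rfl fun i _ => by ring
    have e3 : ∏ j ∈ range m, (-(x + y + 1) + (j : K)) =
        ∏ i ∈ range m, (1 - (x + 1) - (y + 1) + i) :=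
      prod_congr rfl fun i _ => by ring
    rw [e1] at h1
    rw [e2] at h2
    rw [e3] at h3
    have hkm : ((k + m).factorial : K) ≠ 0 := by exact_mod_cast (k + m).factorial_ne_zero
    have hsq : ((-1 : K) ^ k) ^ 2 = 1 := by rw [← pow_mul, pow_mul']; simp
    rw [div_mul_eq_mul_div, eq_div_iff (pow_ne_zero 2 hkm), ht, hu]
    simp only
    calc (-1 : K) ^ k * Ring.choose (-x - 1) k * Ring.choose (-y - 1) k *
          Ring.choose (x + y + 1) m * (((k + m).factorial : K)) ^ 2
        = (-1 : K) ^ k * ((k + m).choose k : K) * (∏ i ∈ range m, ((1 : K) + k + i)) *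
            (((k.factorial : K) * Ring.choose (-x - 1) k) *
              ((k.factorial : K) * Ring.choose (-y - 1) k) *
              ((m.factorial : K) * Ring.choose (x + y + 1) m)) := by
          rw [show (((k + m).factorial : K)) ^ 2 =
            (((k + m).choose k : K) * k.factorial * m.factorial) *
              ((k.factorial : K) * ∏ i ∈ range m, ((1 : K) + k + i)) by rw [h5, h4, sq]]
          ring
      _ = (-1 : K) ^ k * ((k + m).choose k : K) * (∏ i ∈ range m, ((1 : K) + k + i)) *
            (((-1) ^ k * ∏ i ∈ range k, (x + 1 + (i : K))) *
              ((-1) ^ k * ∏ i ∈ range k, (y + 1 + (i : K))) *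
              ((-1) ^ m * ∏ i ∈ range m, (1 - (x + 1) - (y + 1) + (i : K)))) := by
          rw [h1, h2, h3]
      _ = (-1) ^ (k + m) * (((k + m).choose k : K) * (∏ i ∈ range k, (x + 1 + (i : K))) *
            (∏ i ∈ range k, (y + 1 + (i : K))) * (∏ i ∈ range m, ((1 : K) + k + i)) *
            (∏ i ∈ range m, (1 - (x + 1) - (y + 1) + (i : K)))) := by
          rw [pow_add]
          linear_combination ((-1 : K) ^ k * (-1) ^ m * ((k + m).choose k : K) *
            (∏ i ∈ range k, (x + 1 + (i : K))) * (∏ i ∈ range k, (y + 1 + (i : K))) *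
            (∏ i ∈ range m, ((1 : K) + k + i)) *
            (∏ i ∈ range m, (1 - (x + 1) - (y + 1) + (i : K)))) * hsq
  -- sum over the antidiagonal
  have hPS := pfaffSaalschutz_antidiagonal (x + 1) (y + 1) (1 : K) n
  have hn : ((n.factorial : K)) ≠ 0 := by exact_mod_cast n.factorial_ne_zero
  have hx := factorial_mul_choose_eq_neg_pow_mul_prod x n
  have hy := factorial_mul_choose_eq_neg_pow_mul_prod y n
  have ex : ∏ i ∈ range n, ((1 : K) - (x + 1) + i) = ∏ j ∈ range n, (-x + (j : K)) :=
    prod_congr rfl fun i _ => by ring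
  have ey : ∏ i ∈ range n, ((1 : K) - (y + 1) + i) = ∏ j ∈ range n, (-y + (j : K)) :=
    prod_congr rfl fun i _ => by ring
  have hsqn : ((-1 : K) ^ n) ^ 2 = 1 := by rw [← pow_mul, pow_mul']; simp
  calc ∑ r ∈ range (n + 1), (-1 : K) ^ r * Ring.choose (-x - 1) r * Ring.choose (-y - 1) r *
          Ring.choose (x + y + 1) (n - r)
      = ∑ ij ∈ antidiagonal n, t ij.1 ij.2 :=
        (Nat.sum_antidiagonal_eq_sum_range_succ (fun k m => t k m) n).symm
    _ = ∑ ij ∈ antidiagonal n, (-1) ^ n / ((n.factorial : K)) ^ 2 * u ij.1 ij.2 := by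
        refine sum_congr rfl fun ij hij => ?_
        rw [hterm, mem_antidiagonal.mp hij]
    _ = (-1) ^ n / ((n.factorial : K)) ^ 2 *
          ((∏ i ∈ range n, ((1 : K) - (x + 1) + i)) * (∏ i ∈ range n, ((1 : K) - (y + 1) + i))) := by
        rw [← mul_sum, ← hPS]
    _ = (-1 : K) ^ n * Ring.choose x n * Ring.choose y n := by
        rw [ex, ey, div_mul_eq_mul_div, div_eq_iff (pow_ne_zero 2 hn)]
        linear_combination (-((-1 : K) ^ n) ^ 2 * (∏ j ∈ range n, (-y + (j : K)))) * hx +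
          (-(-1 : K) ^ n * ((n.factorial : K) * Ring.choose x n)) * hy +
          (-(-1 : K) ^ n * (∏ j ∈ range n, (-x + (j : K))) * (∏ j ∈ range n, (-y + (j : K)))) *
            hsqn

/-- **Booker–Krishnamurthy 2011, Lemma A.1 (ii)** (p. 710): for `x, y` in a field of
characteristic zero (the paper: `ℂ`) and `n ∈ ℕ`,
`∑_{r=0}^{n} ((-4)^r / C(2r, r)) C(x+y, n-r) C(-x, r) C(-y-½, r) = ((-4)^n / C(2n, n)) C(x-½, n) C(y, n)`,
`C = Ring.choose` the binomial coefficient polynomial (the printed sum is over `r ≥ 0`, its terms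
vanish for `r > n`). Pfaff–Saalschütz at `(a, b, c) = (x, y+½, ½)`.
[cite: BookerKrishnamurthy2011, Lemma A.1 (ii) (p. 710)] -/
theorem lemma_A1_ii (x y : K) (n : ℕ) :
    ∑ r ∈ range (n + 1), (-4 : K) ^ r / ((2 * r).choose r : K) * Ring.choose (x + y) (n - r) *
        Ring.choose (-x) r * Ring.choose (-y - 1 / 2) r =
      (-4 : K) ^ n / ((2 * n).choose n : K) * Ring.choose (x - 1 / 2) n * Ring.choose y n := by
  set u : ℕ → ℕ → K := fun k m => ((k + m).choose k : K) * (∏ i ∈ range k, (x + i)) *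
    (∏ i ∈ range k, (y + 1 / 2 + i)) * (∏ i ∈ range m, ((1 : K) / 2 + k + i)) *
    (∏ i ∈ range m, (1 / 2 - x - (y + 1 / 2) + i)) with hu
  set t : ℕ → ℕ → K := fun k m => (-4 : K) ^ k / ((2 * k).choose k : K) *
    Ring.choose (x + y) m * Ring.choose (-x) k * Ring.choose (-y - 1 / 2) k with ht
  have hterm : ∀ k m : ℕ, t k m = (-1) ^ (k + m) /
      ((((k + m).factorial : K)) * ∏ i ∈ range (k + m), ((1 : K) / 2 + i)) * u k m := by
    intro k m
    have h1 := factorial_mul_choose_eq_neg_pow_mul_prod (-x) k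
    have h2 := factorial_mul_choose_eq_neg_pow_mul_prod (-y - 1 / 2) k
    have h3 := factorial_mul_choose_eq_neg_pow_mul_prod (x + y) m
    have h5 := choose_mul_factorial_mul_factorial_cast (K := K) k m
    have hR4 := neg_four_pow_div_centralBinom (K := K) k
    have hR5 := prod_range_add_shift ((1 : K) / 2) k m
    have e1 : ∏ j ∈ range k, (-(-x) + (j : K)) = ∏ i ∈ range k, (x + i) :=
      prod_congr rfl fun i _ => by ring
    have e2 : ∏ j ∈ range k, (-(-y - 1 / 2) + (j : K)) = ∏ i ∈ range k, (y + 1 / 2 + i) :=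
      prod_congr rfl fun i _ => by ring
    have e3 : ∏ j ∈ range m, (-(x + y) + (j : K)) =
        ∏ i ∈ range m, (1 / 2 - x - (y + 1 / 2) + i) :=
      prod_congr rfl fun i _ => by ring
    rw [e1] at h1
    rw [e2] at h2
    rw [e3] at h3
    have hkm : ((k + m).factorial : K) ≠ 0 := by exact_mod_cast (k + m).factorial_ne_zero
    have hHk := prod_half_add_ne_zero (K := K) k
    have hHkm := prod_half_add_ne_zero (K := K) (k + m)
    have hsq : ((-1 : K) ^ k) ^ 2 = 1 := by rw [← pow_mul, pow_mul']; simp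
    rw [ht, hu]
    simp only
    rw [hR4]
    simp only [div_mul_eq_mul_div]
    rw [div_eq_div_iff hHk (mul_ne_zero hkm hHkm), ← h5, ← hR5]
    linear_combination ((-1 : K) ^ k * ((k + m).choose k : K) *
        (∏ i ∈ range m, ((1 : K) / 2 + k + i)) * (∏ i ∈ range k, ((1 : K) / 2 + i))) *
        (((k.factorial : K) * Ring.choose (-y - 1 / 2) k) *
            ((m.factorial : K) * Ring.choose (x + y) m) * h1 +
          ((-1 : K) ^ k * (∏ i ∈ range k, (x + (i : K)))) *
            ((m.factorial : K) * Ring.choose (x + y) m) * h2 +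
          ((-1 : K) ^ k * (∏ i ∈ range k, (x + (i : K)))) *
            ((-1 : K) ^ k * (∏ i ∈ range k, (y + 1 / 2 + (i : K)))) * h3) +
      ((-1 : K) ^ k * (-1) ^ m * ((k + m).choose k : K) *
        (∏ i ∈ range m, ((1 : K) / 2 + k + i)) * (∏ i ∈ range k, ((1 : K) / 2 + i)) *
        (∏ i ∈ range k, (x + (i : K))) * (∏ i ∈ range k, (y + 1 / 2 + (i : K))) *
        (∏ i ∈ range m, (1 / 2 - x - (y + 1 / 2) + (i : K)))) * hsq
  -- sum over the antidiagonal
  have hPS := pfaffSaalschutz_antidiagonal x (y + 1 / 2) ((1 : K) / 2) n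
  have hn : ((n.factorial : K)) ≠ 0 := by exact_mod_cast n.factorial_ne_zero
  have hHn := prod_half_add_ne_zero (K := K) n
  have hx := factorial_mul_choose_eq_neg_pow_mul_prod (x - 1 / 2) n
  have hy := factorial_mul_choose_eq_neg_pow_mul_prod y n
  have ex : ∏ j ∈ range n, (-(x - 1 / 2) + (j : K)) = ∏ i ∈ range n, ((1 : K) / 2 - x + i) :=
    prod_congr rfl fun i _ => by ring
  have ey : ∏ i ∈ range n, ((1 : K) / 2 - (y + 1 / 2) + i) = ∏ j ∈ range n, (-y + (j : K)) :=
    prod_congr rfl fun i _ => by ring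
  rw [ex] at hx
  have hsqn : ((-1 : K) ^ n) ^ 2 = 1 := by rw [← pow_mul, pow_mul']; simp
  calc ∑ r ∈ range (n + 1), (-4 : K) ^ r / ((2 * r).choose r : K) * Ring.choose (x + y) (n - r) *
          Ring.choose (-x) r * Ring.choose (-y - 1 / 2) r
      = ∑ ij ∈ antidiagonal n, t ij.1 ij.2 :=
        (Nat.sum_antidiagonal_eq_sum_range_succ (fun k m => t k m) n).symm
    _ = ∑ ij ∈ antidiagonal n, (-1) ^ n /
          ((n.factorial : K) * ∏ i ∈ range n, ((1 : K) / 2 + i)) * u ij.1 ij.2 := by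
        refine sum_congr rfl fun ij hij => ?_
        rw [hterm, mem_antidiagonal.mp hij]
    _ = (-1) ^ n / ((n.factorial : K) * ∏ i ∈ range n, ((1 : K) / 2 + i)) *
          ((∏ i ∈ range n, ((1 : K) / 2 - x + i)) *
            (∏ i ∈ range n, ((1 : K) / 2 - (y + 1 / 2) + i))) := by
        rw [← mul_sum, ← hPS]
    _ = (-4 : K) ^ n / ((2 * n).choose n : K) * Ring.choose (x - 1 / 2) n * Ring.choose y n := by
        rw [ey, neg_four_pow_div_centralBinom n]
        simp only [div_mul_eq_mul_div]
        rw [div_eq_div_iff (mul_ne_zero hn hHn) hHn]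
        linear_combination (-(-1 : K) ^ n * (∏ i ∈ range n, ((1 : K) / 2 + i)) *
            ((n.factorial : K) * Ring.choose y n)) * hx +
          (-(-1 : K) ^ n * (∏ i ∈ range n, ((1 : K) / 2 + i)) * (-1 : K) ^ n *
            (∏ i ∈ range n, ((1 : K) / 2 - x + i))) * hy +
          (-(-1 : K) ^ n * (∏ i ∈ range n, ((1 : K) / 2 + i)) *
            (∏ i ∈ range n, ((1 : K) / 2 - x + i)) * (∏ j ∈ range n, (-y + (j : K)))) * hsqn

/-- **Booker–Krishnamurthy 2011, Lemma A.1 (iii)** (p. 710): for `x, y` in a field of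
characteristic zero (the paper: `ℂ`) and `n ∈ ℕ`,
`∑_{r=0}^{n} ((-4)^r / C(2r, r)) ((2n+1)/(2r+1)) C(x+y, n-r) C(-x-1, r) C(-y-½, r)
  = ((-4)^n / C(2n, n)) C(x-½, n) C(y-1, n)`,
`C = Ring.choose` the binomial coefficient polynomial (the printed sum is over `r ≥ 0`, its terms
vanish for `r > n`). Pfaff–Saalschütz at `(a, b, c) = (x+1, y+½, 3/2)`.
[cite: BookerKrishnamurthy2011, Lemma A.1 (iii) (p. 710)] -/
theorem lemma_A1_iii (x y : K) (n : ℕ) :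
    ∑ r ∈ range (n + 1), (-4 : K) ^ r / ((2 * r).choose r : K) * ((2 * n + 1) / (2 * r + 1)) *
        Ring.choose (x + y) (n - r) * Ring.choose (-x - 1) r * Ring.choose (-y - 1 / 2) r =
      (-4 : K) ^ n / ((2 * n).choose n : K) * Ring.choose (x - 1 / 2) n *
        Ring.choose (y - 1) n := by
  set u : ℕ → ℕ → K := fun k m => ((k + m).choose k : K) * (∏ i ∈ range k, (x + 1 + i)) *
    (∏ i ∈ range k, (y + 1 / 2 + i)) * (∏ i ∈ range m, ((3 : K) / 2 + k + i)) *
    (∏ i ∈ range m, (3 / 2 - (x + 1) - (y + 1 / 2) + i)) with hu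
  set t : ℕ → ℕ → K := fun k m => (-4 : K) ^ k / ((2 * k).choose k : K) *
    ((2 * n + 1) / (2 * k + 1)) * Ring.choose (x + y) m * Ring.choose (-x - 1) k *
    Ring.choose (-y - 1 / 2) k with ht
  have hterm : ∀ k m : ℕ, t k m = (-1) ^ (k + m) * (2 * n + 1) /
      ((((k + m).factorial : K)) * ∏ i ∈ range (k + m), ((3 : K) / 2 + i)) * u k m := by
    intro k m
    have h1 := factorial_mul_choose_eq_neg_pow_mul_prod (-x - 1) k
    have h2 := factorial_mul_choose_eq_neg_pow_mul_prod (-y - 1 / 2) k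
    have h3 := factorial_mul_choose_eq_neg_pow_mul_prod (x + y) m
    have h5 := choose_mul_factorial_mul_factorial_cast (K := K) k m
    have hR4 := neg_four_pow_div_centralBinom_div (K := K) k
    have hR5 := prod_range_add_shift ((3 : K) / 2) k m
    have e1 : ∏ j ∈ range k, (-(-x - 1) + (j : K)) = ∏ i ∈ range k, (x + 1 + i) :=
      prod_congr rfl fun i _ => by ring
    have e2 : ∏ j ∈ range k, (-(-y - 1 / 2) + (j : K)) = ∏ i ∈ range k, (y + 1 / 2 + i) :=
      prod_congr rfl fun i _ => by ring
    have e3 : ∏ j ∈ range m, (-(x + y) + (j : K)) =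
        ∏ i ∈ range m, (3 / 2 - (x + 1) - (y + 1 / 2) + i) :=
      prod_congr rfl fun i _ => by ring
    rw [e1] at h1
    rw [e2] at h2
    rw [e3] at h3
    have hkm : ((k + m).factorial : K) ≠ 0 := by exact_mod_cast (k + m).factorial_ne_zero
    have hGk := prod_three_halves_add_ne_zero (K := K) k
    have hGkm := prod_three_halves_add_ne_zero (K := K) (k + m)
    have hsq : ((-1 : K) ^ k) ^ 2 = 1 := by rw [← pow_mul, pow_mul']; simp
    rw [ht, hu]
    simp only
    rw [show (-4 : K) ^ k / ((2 * k).choose k : K) * ((2 * n + 1) / (2 * k + 1)) =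
      (2 * n + 1) * ((-4 : K) ^ k / ((2 * k).choose k : K) / (2 * k + 1)) by ring, hR4]
    simp only [div_mul_eq_mul_div, mul_div_assoc']
    rw [div_eq_div_iff hGk (mul_ne_zero hkm hGkm), ← h5, ← hR5]
    linear_combination ((2 * (n : K) + 1) * (-1 : K) ^ k * ((k + m).choose k : K) *
        (∏ i ∈ range m, ((3 : K) / 2 + k + i)) * (∏ i ∈ range k, ((3 : K) / 2 + i))) *
        (((k.factorial : K) * Ring.choose (-y - 1 / 2) k) *
            ((m.factorial : K) * Ring.choose (x + y) m) * h1 +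
          ((-1 : K) ^ k * (∏ i ∈ range k, (x + 1 + (i : K)))) *
            ((m.factorial : K) * Ring.choose (x + y) m) * h2 +
          ((-1 : K) ^ k * (∏ i ∈ range k, (x + 1 + (i : K)))) *
            ((-1 : K) ^ k * (∏ i ∈ range k, (y + 1 / 2 + (i : K)))) * h3) +
      ((2 * (n : K) + 1) * (-1 : K) ^ k * (-1) ^ m * ((k + m).choose k : K) *
        (∏ i ∈ range m, ((3 : K) / 2 + k + i)) * (∏ i ∈ range k, ((3 : K) / 2 + i)) *
        (∏ i ∈ range k, (x + 1 + (i : K))) * (∏ i ∈ range k, (y + 1 / 2 + (i : K))) *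
        (∏ i ∈ range m, (3 / 2 - (x + 1) - (y + 1 / 2) + (i : K)))) * hsq
  -- sum over the antidiagonal
  have hPS := pfaffSaalschutz_antidiagonal (x + 1) (y + 1 / 2) ((3 : K) / 2) n
  have hn : ((n.factorial : K)) ≠ 0 := by exact_mod_cast n.factorial_ne_zero
  have hGn := prod_three_halves_add_ne_zero (K := K) n
  have h21 : (2 * (n : K) + 1) ≠ 0 := by exact_mod_cast Nat.succ_ne_zero (2 * n)
  have hx := factorial_mul_choose_eq_neg_pow_mul_prod (x - 1 / 2) n
  have hy := factorial_mul_choose_eq_neg_pow_mul_prod (y - 1) n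
  have ex : ∏ j ∈ range n, (-(x - 1 / 2) + (j : K)) = ∏ i ∈ range n, ((3 : K) / 2 - (x + 1) + i) :=
    prod_congr rfl fun i _ => by ring
  have ey : ∏ j ∈ range n, (-(y - 1) + (j : K)) = ∏ i ∈ range n, ((3 : K) / 2 - (y + 1 / 2) + i) :=
    prod_congr rfl fun i _ => by ring
  rw [ex] at hx
  rw [ey] at hy
  have hsqn : ((-1 : K) ^ n) ^ 2 = 1 := by rw [← pow_mul, pow_mul']; simp
  calc ∑ r ∈ range (n + 1), (-4 : K) ^ r / ((2 * r).choose r : K) * ((2 * n + 1) / (2 * r + 1)) *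
          Ring.choose (x + y) (n - r) * Ring.choose (-x - 1) r * Ring.choose (-y - 1 / 2) r
      = ∑ ij ∈ antidiagonal n, t ij.1 ij.2 :=
        (Nat.sum_antidiagonal_eq_sum_range_succ (fun k m => t k m) n).symm
    _ = ∑ ij ∈ antidiagonal n, (-1) ^ n * (2 * n + 1) /
          ((n.factorial : K) * ∏ i ∈ range n, ((3 : K) / 2 + i)) * u ij.1 ij.2 := by
        refine sum_congr rfl fun ij hij => ?_
        rw [hterm, mem_antidiagonal.mp hij]
    _ = (-1) ^ n * (2 * n + 1) / ((n.factorial : K) * ∏ i ∈ range n, ((3 : K) / 2 + i)) *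
          ((∏ i ∈ range n, ((3 : K) / 2 - (x + 1) + i)) *
            (∏ i ∈ range n, ((3 : K) / 2 - (y + 1 / 2) + i))) := by
        rw [← mul_sum, ← hPS]
    _ = (-4 : K) ^ n / ((2 * n).choose n : K) * Ring.choose (x - 1 / 2) n *
          Ring.choose (y - 1) n := by
        rw [show (-4 : K) ^ n / ((2 * n).choose n : K) =
          (2 * n + 1) * ((-4 : K) ^ n / ((2 * n).choose n : K) / (2 * n + 1)) by
            rw [mul_div_assoc', mul_div_cancel_left₀ _ h21],
          neg_four_pow_div_centralBinom_div n]
        simp only [div_mul_eq_mul_div, mul_div_assoc']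
        rw [div_eq_div_iff (mul_ne_zero hn hGn) hGn]
        linear_combination (-(2 * (n : K) + 1) * (-1 : K) ^ n *
            (∏ i ∈ range n, ((3 : K) / 2 + i)) * ((n.factorial : K) * Ring.choose (y - 1) n)) * hx +
          (-(2 * (n : K) + 1) * (-1 : K) ^ n * (∏ i ∈ range n, ((3 : K) / 2 + i)) * (-1 : K) ^ n *
            (∏ i ∈ range n, ((3 : K) / 2 - (x + 1) + i))) * hy +
          (-(2 * (n : K) + 1) * (-1 : K) ^ n * (∏ i ∈ range n, ((3 : K) / 2 + i)) *
            (∏ i ∈ range n, ((3 : K) / 2 - (x + 1) + i)) *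
            (∏ i ∈ range n, ((3 : K) / 2 - (y + 1 / 2) + i))) * hsqn

end BookerKrishnamurthy

end Literature.NumberTheory.Automorphic
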